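import Summits.QuantumFields.YangMills.Theorems.BalabanUVNodesN12AtRecord12LiveSelector
import Literature.MathematicalPhysics.QuantumFieldTheory.Balaban1983to89.B16RLeafRecord12AtLive

/-!
# BalabanUVNodes ∕ N12 ON THE K0′ WITNESS LINE OF RECORD — the `NodesAtSomeRecord12` body at a LIVE RE-PIN with the rev-15 GUARD, ADMISSIBILITY and N13's POINTED 𝐑-ROW
# DISCHARGED BY NAME, N12 read at its bundle of record; then at plan g65's witness `θ₀ˡⁱᵛᵉ` with every K0′-side input but `Provisos₁₂` a theorem
# (sequel of `BalabanUVNodesN12AtRecord12LiveSelector`; Track A, DAG node N12 = [B15, Balaban1989LargeFieldI] CMP 122 (1989) 175; cluster K1′ `StabilityBAtRecordR12e` =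
# stmt-QuantumFields-19903 (rev 15); seat `pub-ymgap-dag-n12-d` g5 (R134 s2, HANDOFF trigger t6), 2026-08-27; count-neutral, NOT a discharge)

HONEST FRAMING.  Count-neutral kernel BOOKKEEPING BY NAME over landed modules; nothing of Bałaban's is asserted; `Provisos₁₂` at the re-pinned witness is NOT claimed
(K0′ `Record12Inhabited`, stmt-QuantumFields-19902 — its one open hypothesis after node00-def-K0a's `exists_k0prime_of_theta12Live_of_provisos₁₂`); N12 NOT discharged.

WHY THIS FILE.  Module 2 of this seat (`…N12AtRecord12LiveSelector` §5) typed dag-n24-c's CLOSER INTERFACE for `stub_nodes12` (module 27 `Node00.N24NodesStage12Pointed`) at a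
live re-pin `Θ.liveRepin` with N12 read at its bundle of record and `hfib` gone, but still DISPLAYED three inputs that are now THEOREMS of the tree:
(i) the guard conjunct `SlotsNondegenerate` at the re-pin — node00-def-K0a's `Stage12Params.slotsNondegenerate_liveRepin` (`Record12LiveSelectorTorus` v1.1, landed the same
minute as module 2) from the `base` field (`Provisos₁₀`) of the provisos at the re-pin, under def-T's `Record12` v2.3 level guard;
(ii) N13's POINTED 𝐑-ROW `hR : ∀ P k < K, TLaw₁₂ (Θ.liveRepin) P k → SLaw₁₂ (Θ.liveRepin) P (k+1)` — by def-T's `rOpLeaf_VOfRecord₁₂_iff` this IS `ROpLeaf (VOfRecord₁₂ (Θ.liveRepin) P)`,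
which dag-n11-e's `B16RLeafRecord12AtLive.rOpLeaf_VOfRecord₁₂_liveRepin` proves at EVERY live re-pin from the provisos there, admissibility, the signs `0 ≤ κ, E₀, B₀` and
`0 ≤ g_{k+1}` (at a live re-pin 𝐑 of record moves only DEAD sequences, so it integrates nothing out of a present term: [III] p.244's leaf is Theorem 2's shape term by term);
(iii) `0 ≤ g_{k+1}` itself — FREE for every run at every Stage-9 parameter: `gOfRecord₁₀ θ p (k+1) = solveCoupling (…)` and `FlowStepRuns.solveCoupling y` is `y^{-1∕2}` or `0` (§0).
So on a live re-pin the K0′-side cost of the `stub_nodes12` body is `Provisos₁₂` + `Admissible` + `ZtUnity` + three signs of `Θ`, and AT THE WITNESS OF RECORD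
`θ₀ˡⁱᵛᵉ = theta12LiveOfRecord F N (zeta316OfRecord … 1 1) (RzOfRecord) (ZtOfRecord)` (plan g65 SKELETON v4-LIVE `thetaLive`, pub-ymgap INBOX l.15090) all of these but
`Provisos₁₂` are K0a ∕ K0b ∕ n11-e theorems (`admissible_theta12LiveOfRecord`, `ztUnity_theta12LiveOfRecord`, `kappa∕E0∕B0_nonneg_theta12OfRecord`).
WHAT THIS FILE PROVES (theorems only).
* §0 `solveCoupling_nonneg`, `genSeq_succ_nonneg`, `gOfRecord₁₀_succ_nonneg` (elementary; voids the `hg` binder of n11-e's 𝐑-leaf theorems everywhere).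
* §1 AT ANY LIVE RE-PIN: `rRow_liveRepin` (module 27's N13 pointed 𝐑-row, a THEOREM modulo provisos ∕ admissibility ∕ signs), `rOperation_leavesP_liveRepin_pinW` (world form over
  any W-pin of the re-pin), `guard_liveRepin_of_ztUnity` (the rev-15 guard pair at the re-pin from `Θ.ZtUnity` and `Provisos₁₀` there).
* §2 AT ANY LIVE RE-PIN, N12 READ AT ITS BUNDLE OF RECORD `pinW (WOfRecord₁₂ (Θ.liveRepin) λ⁴)`: the POINTED conclusion `IsRecordOfRecord₁₂C … w ∧ ∀ P, Nodes (leavesP w P)` at the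
  closer's own bound world (`nodes₁₂_pointed_liveRepin_pinW_of_massSel_of_signs`) and the ∃-body (`nodesAtSomeRecord₁₂_of_pointed_liveRepin_pinW_of_massSel_of_signs`) — module 2
  §5 with `hnd` AND `hR` DISCHARGED; displayed: `Provisos₁₂` at the re-pin, `Θ.Admissible`, `Θ.ZtUnity`, the three signs, rows N05–N11 + Cor.-3, N12's displays at `λ⁴`.
* §3 AT `θ₀ˡⁱᵛᵉ = theta12LiveOfRecord F N ζ Rz Zt` for ANY residual objects (the K1′ witness-to-be as much as the K0′ inhabitant): `rRow_theta12Live` and the ∃-body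
  `nodesAtSomeRecord₁₂_of_pointed_theta12Live_pinW_of_massSel` — K0′ side = `Provisos₁₂` + `ZtUnity` (K0b proves the latter at `Zt := ZtOfRecord` only).
* §4 AT THE WITNESS OF RECORD (K0b's residuals): `k0primeSide_and_rRow_at_thetaLiveOfRecord` (generic `N`: from `hP` alone the guard pair, admissibility AND N13's 𝐑-row —
  so §3's K0′ side there = `Provisos₁₂` ALONE) and, at `N = 2`, `k0prime_and_rRow_of_thetaLive_provisos_two` (K0a's K0′ body for `F` ∧ the 𝐑-row, from ONE `hP`).
WHICH CHILD BLOCKS, on the witness line of record (typing strength, NOT a second gap; cf. dag-n11-d's reading pub-ymgap INBOX l.14524: N11's (S1ᵀ) at level 0 is EXPECTED TO FAIL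
at K0b's uniform `ζ0`, so §4's `h11` may be unsatisfiable there and §3's generic-residual form is the one a K1′ witness will use): K0′ `Provisos₁₂ θ₀ˡⁱᵛᵉ`; N05 ∕ N06 ∕ N07 ∕ N08 ∕
N09 ∕ N10 rows at `θ₀`'s residual carriers; N11 (S1ᵀ); Cor.-3 ×5 at the datum; N12 = `hdeg`, `hmassSel` (⟺ positive mass of the LIVE terms below the torus, module 2 §3),
Prop. 1 at `λ.LF P` (dag-n12-c), (1.80) + (1.89) at the pinned letters (dag-n12-e).  N13's 𝐑-row, the guard and admissibility: THEOREMS.  One finite four-torus programme at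
fixed `ε`; nothing continuum ∕ ℝ⁴ ∕ OS ∕ mass gap ∕ Clay.  0 `sorry`, 0 `def`, standard axioms.  Filed `--supports` K1′ (19903) `--as helper`.
Sources: [Balaban1989LargeFieldI] (0.2)–(0.6) pp.176–177, Prop. 1 p.194, (1.80) p.195, (1.89) p.198; [Balaban1988Convergent] p.244, (2.18) p.257, Thm 2 p.263, (3.16)–(3.25)
pp.268–270; [Balaban1989LargeFieldII] Thm 1 + (0.1) pp.355–356, p.391; [Balaban1987RG1] (0.17)–(0.20) pp.255–256.
-/

noncomputable section

open MeasureTheory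
open scoped Matrix.Norms.L2Operator

namespace Summit.QuantumFields.YangMills.BalabanUVNodes.N12AtRecord12WitnessLine
open Literature.MathematicalPhysics.QuantumFieldTheory.Balaban1983to89
open Literature.MathematicalPhysics.QuantumFieldTheory.Balaban1983to89.T4Continuum (T4Family)
open Literature.MathematicalPhysics.QuantumFieldTheory.Balaban1983to89.DagBinding (WorldP leavesP PrintedCarriersR PrintedCarriers15 B15Leaf B8LeafR B9LeafX B11Leaf Nodes)
open Literature.MathematicalPhysics.QuantumFieldTheory.Balaban1983to89.Node00
open FlowStepRuns (solveCoupling genSeq genSeq_succ)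
open FlowStep (HBeta)
open B15Claim189Assembly (new189 chiPP dom)
open B15 (Prop1Printed Ineq180)
open B15.BasicStep (Claim189)
open B8Eq17ClassAkV1 (plaqsOf)
open B16RLeafRecord12AtLive (rOpLeaf_VOfRecord₁₂_liveRepin kappa_nonneg_theta12OfRecord E0_nonneg_theta12OfRecord B0_nonneg_theta12OfRecord)
open Summit.QuantumFields.YangMills.BalabanUVNodes.N12AtRecord12Pointed (nodes₁₂_pointed_pinW)
open Summit.QuantumFields.YangMills.BalabanUVNodes.N12AtRecord12LiveSelector
  (b15Leaf_WOfRecord₁₀_pinAllχ₀_liveRepin_of_deg_massSel nodesAtSomeRecord₁₂_of_pointed_liveRepin_pinW_of_massSel)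

variable {N : ℕ} [NeZero N] {F : T4Family}

/-! ## §0 The generated couplings are non-negative from step 1 on — for free -/

section Couplings

/-- `solveCoupling y ≥ 0`: it is `y^{-1∕2}` when `y > 0` and `0` («no coupling») otherwise. [cite: Balaban1987RG1, (0.18)–(0.20) pp.255–256 (folklore sign)] -/
theorem solveCoupling_nonneg (y : ℝ) : 0 ≤ solveCoupling y := by
  unfold solveCoupling
  split_ifs
  · positivity
  · exact le_rfl

/-- Every generated coupling after the bare one is `≥ 0` (`genSeq β g₀ (k+1) = solveCoupling (…)`). [cite: Balaban1987RG1, (0.18)–(0.20) pp.255–256 (folklore sign)] -/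
theorem genSeq_succ_nonneg (β : HBeta) (g0 : ℝ) (k : ℕ) : 0 ≤ genSeq β g0 (k + 1) := by
  rw [genSeq_succ]; exact solveCoupling_nonneg _

/-- **`0 ≤ g_{k+1}` FOR EVERY RUN AT EVERY STAGE-9 PARAMETER** (`gOfRecord₁₀ θ p = genSeq β₁₀ g₀`): the sign binder `hg` of dag-n11-e's 𝐑-leaf theorems is void.
[cite: Balaban1987RG1, (0.17)–(0.20) pp.255–256 (bookkeeping)] -/
theorem gOfRecord₁₀_succ_nonneg (θ : Stage9Params F N) (p : B12.RunParams) (k : ℕ) : 0 ≤ gOfRecord₁₀ F N θ p (k + 1) :=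
  genSeq_succ_nonneg _ _ k

end Couplings

/-! ## §1 At any live re-pin `Θ.liveRepin`: N13's pointed 𝐑-row and the rev-15 guard are theorems -/

section Repin
variable (Θ : Stage12Params F N)

/-- **★ N13's POINTED 𝐑-ROW OF MODULE 27 IS A THEOREM AT EVERY LIVE RE-PIN** — `∀ P k < K, TLaw₁₂ (Θ.liveRepin) P k → SLaw₁₂ (Θ.liveRepin) P (k+1)` from the provisos at the
re-pin, admissibility and the signs `0 ≤ κ, E₀, B₀` of `Θ`: def-T's `rOpLeaf_VOfRecord₁₂_iff` ∘ dag-n11-e's `rOpLeaf_VOfRecord₁₂_liveRepin` (𝐑 of record at a live re-pin moves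
only dead sequences — [IV] p.177 (i)–(ii) —, so Theorem 2's shape passes term by term) ∘ §0 (`0 ≤ g_{k+1}` free).  [B16] Theorem 1's 𝐑-construction is NOT exercised on this
branch; nothing of it is asserted. [cite: Balaban1988Convergent, p.244, Thm 2 p.263, §2 p.262; Balaban1989LargeFieldI, (0.3) p.176, p.177 (i)–(ii); Balaban1989LargeFieldII, Thm 1 p.355 (not exercised)] -/
theorem rRow_liveRepin (hP : (Θ.liveRepin F N).Provisos₁₂ F N) (hθ : Θ.Admissible F N) (hκ : 0 ≤ Θ.s2.lf.κ) (hE₀ : 0 ≤ Θ.s2.lf.E₀)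
    (hB₀ : 0 ≤ Θ.s2.lf.B₀) :
    ∀ (P : B12.RunParams) (k : ℕ), k < P.K → TLaw₁₂ F N (Θ.liveRepin F N) P k → SLaw₁₂ F N (Θ.liveRepin F N) P (k + 1) :=
  fun P => (rOpLeaf_VOfRecord₁₂_iff F N (Θ.liveRepin F N) P).1
    (rOpLeaf_VOfRecord₁₂_liveRepin F N Θ P hP hθ hκ hE₀ hB₀ fun k _ => gOfRecord₁₀_succ_nonneg Θ.toStage9Params P k)

/-- **World form**: at a world bound over ANY W-pin of the live re-pin (`w.up P = upOfRecord₅C ((Θ.liveRepin).pinW W₀).toStage5₁₂ P` — the pin keeps `SLaw₁₂ ∕ TLaw₁₂`,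
module 1 §1), the run's `rOperation` leaf HOLDS. [cite: Balaban1988Convergent, p.244; Balaban1989LargeFieldII, Thm 1 p.355 (bookkeeping)] -/
theorem rOperation_leavesP_liveRepin_pinW (hP : (Θ.liveRepin F N).Provisos₁₂ F N) (hθ : Θ.Admissible F N) (hκ : 0 ≤ Θ.s2.lf.κ)
    (hE₀ : 0 ≤ Θ.s2.lf.E₀) (hB₀ : 0 ≤ Θ.s2.lf.B₀) (W₀ : B12.RunParams → PrintedCarriers15) (w : WorldP) (P : B12.RunParams)
    (hup : w.up P = upOfRecord₅C F N (((Θ.liveRepin F N).pinW F N W₀).toStage5₁₂ F N) P) : (leavesP w P).rOperation := by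
  show (w.up P).rOperation
  rw [hup]
  exact (rOperation_upOfRecord₅C_stage12_iff F N ((Θ.liveRepin F N).pinW F N W₀) P).2 (rRow_liveRepin Θ hP hθ hκ hE₀ hB₀ P)

/-- **The rev-15 guard pair at the live re-pin** from print's partition of unity at `Θ` (the re-pin touches only the selector, K0a `ZtUnity.liveRepin`) and `Provisos₁₀` at the
re-pin (K0a `slotsNondegenerate_liveRepin`: live sequences exist up to the torus by K0b's `exists_live_slotsTOfRecord_succ_rterm`; def-T `Record12` v2.3 guard).
[cite: Balaban1988Convergent, (3.16)–(3.22) pp.268–269, (3.24) p.270; Balaban1989LargeFieldI, (0.3)–(0.4) p.176] -/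
theorem guard_liveRepin_of_ztUnity (hzt : Θ.ZtUnity F N) (hP : (Θ.liveRepin F N).toStage9Params.Provisos₁₀) :
    (Θ.liveRepin F N).ZtUnity F N ∧ (Θ.liveRepin F N).SlotsNondegenerate :=
  ⟨hzt.liveRepin, Stage12Params.slotsNondegenerate_liveRepin F N Θ hP⟩

end Repin

/-! ## §2 At any live re-pin, N12 read at its bundle of record: the pointed conclusion and the `NodesAtSomeRecord12` body — guard and 𝐑-row discharged -/

section Body
variable (Θ : Stage12Params F N) (hP : (Θ.liveRepin F N).Provisos₁₂ F N) (lam : ResidW F N) (σ : ∀ P : B12.RunParams, Sit189 F N P.K) (p₁ : ℕ)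

/-- **★ THE THIRTEEN NODES AT THE CLOSER's OWN WORLD, BOUND TO THE LIVE RE-PIN W-PINNED AT ITS BUNDLE OF RECORD** — module 1's `nodes₁₂_pointed_pinW` at `θ := Θ.liveRepin`,
`W₀ := WOfRecord₁₂ (Θ.liveRepin) λ⁴` (`λ⁴ := (λ.pinRPrime θ₉).pinD189χ₀ θ₉ σ p₁`, `θ₉` the re-pin's Stage-9 tuple): the N12 row is module 2's
`b15Leaf_WOfRecord₁₀_pinAllχ₀_liveRepin_of_deg_massSel` (no fibre witness), N13's 𝐑-row is §1's THEOREM, rows N05–N10 are at `Θ`'s residual carriers verbatim, N11's (S1ᵀ) and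
the Cor.-3 leaves as module 27.  DISPLAYED: `Provisos₁₂` at the re-pin (K0′), `Θ.Admissible`, the signs `0 ≤ κ, E₀, B₀`, N12's `hdeg ∧ hmassSel ∧ Prop 1 ∧ (1.80) ∧ (1.89)` at `λ⁴`.
Conclusion at `w` itself: the record predicate over `datumOfRecord₁₂ (Θ.liveRepin) hP` and `Nodes` at every run.  COMPOSITE; NOT a discharge; count-neutral.
[cite: Balaban1989LargeFieldII, Thm 1 p.355, (0.1) pp.355–356, p.391; Balaban1989LargeFieldI, (0.2)–(0.6) p.176, p.176 ll.14–16, p.177, Prop. 1 (1.78) p.194, (1.80) p.195, (1.89) p.198; Balaban1988Convergent, p.244, Thm 2 p.263 (node bookkeeping at the re-pin's objects)] -/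
theorem nodes₁₂_pointed_liveRepin_pinW_of_massSel_of_signs (hθ : Θ.Admissible F N) (hκ : 0 ≤ Θ.s2.lf.κ) (hE₀ : 0 ≤ Θ.s2.lf.E₀) (hB₀ : 0 ≤ Θ.s2.lf.B₀)
    (w : WorldP) (hC : w.C = (datumOfRecord₁₂ F N (Θ.liveRepin F N) hP).C) (hγ : 0 < w.γ ∧ w.γ ≤ Θ.γ) (hL : w.L = (Θ.L : ℝ))
    (hup : ∀ P, w.up P = upOfRecord₅C F N (((Θ.liveRepin F N).pinW F N (WOfRecord₁₂ F N (Θ.liveRepin F N)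
      ((lam.pinRPrime (Θ.liveRepin F N).toStage9Params).pinD189χ₀ (Θ.liveRepin F N).toStage9Params σ p₁))).toStage5₁₂ F N) P)
    (h05 : ∀ P : B12.RunParams,
      B8LeafR (Θ.res.X P).d8 (Θ.res.X P).L8 (Θ.res.X P).C₂ (Θ.res.X P).B₁' (Θ.res.X P).B₀' (Θ.res.X P).B₁ (Θ.res.X P).B₂ (Θ.res.X P).c₁
        (Θ.res.X P).inp8 (Θ.res.X P).B₀β (Θ.res.X P).loc8 (Θ.res.X P).fam8R (Θ.res.X P).lan8 (Θ.res.X P).cub8 (Θ.res.X P).toAxial8)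
    (h06 : ∀ P : B12.RunParams, B9LeafX (Θ.res.Y P))
    (h07 : ∀ P : B12.RunParams, B11Leaf (Θ.res.Z P))
    (h08 : ∀ P : B12.RunParams, ∃ (Xc : PrintedCarriersR) (I : Type) (C : B10Assembly.Consts) (T : I → B10.TowerRun),
      Nonempty (∀ i, B10Assembly.LeafSystem C (T i)) ∧ Θ.res.X P = Xc.withTowerRuns10 T)
    (h09 : ∀ P : B12.RunParams, B12Sec2to5.Lemma4Printed (Θ.res.X P).F12 (Θ.res.X P).c12)
    (h09T : ∀ P : B12.RunParams, (leavesP w P).smallCouplings → (leavesP w P).smallFieldInductive)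
    (h10 : ∀ P : B12.RunParams, B9LeafX (Θ.res.Y P) →
      (B10.Thm1PrintedCompact (Θ.res.X P).runs10 ∧ B10.Thm2Printed (Θ.res.X P).runs10) →
        B11Leaf (Θ.res.Z P) → B12Sec2to5.Lemma4Printed (Θ.res.X P).F12 (Θ.res.X P).c12 →
          B13.Lemma1Printed (Θ.res.X P).S13 (Θ.res.X P).c13 ∧ B13.Lemma2Printed (Θ.res.X P).S13 (Θ.res.X P).c13 ∧
            B13.Lemma3Printed (Θ.res.X P).S13 (Θ.res.X P).c13)
    (h11 : ∀ P : B12.RunParams, (leavesP w P).b7 → (leavesP w P).b8 → (leavesP w P).b9 → (leavesP w P).b10 → (leavesP w P).b11 →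
      (leavesP w P).smallCouplings → (leavesP w P).smallFieldInductive → (leavesP w P).flowControl →
        ∀ k, k < P.K → SLaw₁₂ F N (Θ.liveRepin F N) P k → TLaw₁₂ F N (Θ.liveRepin F N) P k)
    (hN12 : ∀ P : B12.RunParams,
      (P.K ≤ lam.kSel P →
        (repDataOfSel (repTOfRecord9 F N Θ.ν Θ.τ9 (EOfRecord₁₀ F N (Θ.liveRepin F N).toStage9Params) (wOfRecord₉ F N (Θ.liveRepin F N).toStage9Params)
            (Θ.liveRepin F N).ppSel P (gOfRecord₁₀ F N (Θ.liveRepin F N).toStage9Params P) (lam.kSel P))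
          ((Θ.liveRepin F N).ppSel P (gOfRecord₁₀ F N (Θ.liveRepin F N).toStage9Params P) (lam.kSel P + 1))
          (fibOfSeq F Θ.ν Θ.τ9 P (gOfRecord₁₀ F N (Θ.liveRepin F N).toStage9Params P) (lam.kSel P + 1))).ProvisosSupp) ∧
      (∀ s, 0 < ∫ V, rterm (repTOfRecord9 F N Θ.ν Θ.τ9 (EOfRecord₁₀ F N (Θ.liveRepin F N).toStage9Params) (wOfRecord₉ F N (Θ.liveRepin F N).toStage9Params)
        (Θ.liveRepin F N).ppSel P (gOfRecord₁₀ F N (Θ.liveRepin F N).toStage9Params P) (lam.kSel P))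
        ((Θ.liveRepin F N).ppSel P (gOfRecord₁₀ F N (Θ.liveRepin F N).toStage9Params P) (lam.kSel P + 1) s) V ∂(fieldMeasure (F.P P.K) (lam.kSel P + 1) (SU N))) ∧
      Prop1Printed (lam.LF P) ∧
      (∀ U, new189 (((lam.pinRPrime (Θ.liveRepin F N).toStage9Params).pinD189χ₀ (Θ.liveRepin F N).toStage9Params σ p₁).D189 P) U →
        ∀ i, (((lam.pinRPrime (Θ.liveRepin F N).toStage9Params).pinD189χ₀ (Θ.liveRepin F N).toStage9Params σ p₁).D189 P).h ≤ i →
          i ≤ (((lam.pinRPrime (Θ.liveRepin F N).toStage9Params).pinD189χ₀ (Θ.liveRepin F N).toStage9Params σ p₁).D189 P).k →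
            ∀ q ∈ plaqsOf (dom (((lam.pinRPrime (Θ.liveRepin F N).toStage9Params).pinD189χ₀ (Θ.liveRepin F N).toStage9Params σ p₁).D189 P) i),
              Ineq180 ((((lam.pinRPrime (Θ.liveRepin F N).toStage9Params).pinD189χ₀ (Θ.liveRepin F N).toStage9Params σ p₁).D189 P).dev0 U q)
                ((((lam.pinRPrime (Θ.liveRepin F N).toStage9Params).pinD189χ₀ (Θ.liveRepin F N).toStage9Params σ p₁).D189 P).ε
                  (((lam.pinRPrime (Θ.liveRepin F N).toStage9Params).pinD189χ₀ (Θ.liveRepin F N).toStage9Params σ p₁).D189 P).k)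
                (((lam.pinRPrime (Θ.liveRepin F N).toStage9Params).pinD189χ₀ (Θ.liveRepin F N).toStage9Params σ p₁).D189 P).η
                (σ P).B₃ (σ P).B₅ (σ P).M (σ P).δ ((σ P).dist q) (σ P).O1) ∧
      Claim189 (new189 (((lam.pinRPrime (Θ.liveRepin F N).toStage9Params).pinD189χ₀ (Θ.liveRepin F N).toStage9Params σ p₁).D189 P))
        (chiPP (((lam.pinRPrime (Θ.liveRepin F N).toStage9Params).pinD189χ₀ (Θ.liveRepin F N).toStage9Params σ p₁).D189 P)))
    (hcor3 : ∃ R : B14Cor3.ReprFamily (datumOfRecord₁₂ F N (Θ.liveRepin F N) hP).C,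
      B14Cor3.LeafH (datumOfRecord₁₂ F N (Θ.liveRepin F N) hP).C R w.γ ∧ B14Cor3.LeafU1 (datumOfRecord₁₂ F N (Θ.liveRepin F N) hP).C R w.γ ∧
        B14Cor3.LeafU2 (datumOfRecord₁₂ F N (Θ.liveRepin F N) hP).C R w.γ w.ep ∧ B14Cor3.LeafL1 (datumOfRecord₁₂ F N (Θ.liveRepin F N) hP).C R w.γ ∧
          B14Cor3.LeafL2 (datumOfRecord₁₂ F N (Θ.liveRepin F N) hP).C R w.γ w.em) :
    IsRecordOfRecord₁₂C F N (datumOfRecord₁₂ F N (Θ.liveRepin F N) hP) w ∧ ∀ P : B12.RunParams, Nodes (leavesP w P) :=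
  nodes₁₂_pointed_pinW (Θ.liveRepin F N) hP hθ.liveRepin _ w hC hγ hL hup h05 h06 h07 h08 h09 h09T h10 h11
    (fun P => by
      obtain ⟨hdeg, hmassSel, hP1, h180, h189⟩ := hN12 P
      exact b15Leaf_WOfRecord₁₀_pinAllχ₀_liveRepin_of_deg_massSel Θ lam σ p₁ hP.base hdeg hmassSel hP1 h180 h189)
    (rRow_liveRepin Θ hP hθ hκ hE₀ hB₀) hcor3

/-- **★ THE BODY OF `NodesAtSomeRecord12` AT A LIVE RE-PIN, N12 READ AT ITS BUNDLE OF RECORD — `hfib`, `hnd` AND `hR` GONE** (module 2 §5 with the guard conjunct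
`SlotsNondegenerate` := K0a's `slotsNondegenerate_liveRepin hP.base` and N13's 𝐑-row := §1's `rRow_liveRepin`): from `Provisos₁₂` at the re-pin (K0′), admissibility, print's
partition of unity and the signs `0 ≤ κ, E₀, B₀` of `Θ`, a world bound to the W-pinned re-pin, rows N05–N11 + Cor.-3 as module 27, and N12's displays at `λ⁴`, the stub's ∃-text
is witnessed by the W-pinned re-pin itself.  COMPOSITE; NOT a discharge; count-neutral. [cite: Balaban1989LargeFieldII, Thm 1 p.355 + p.391; Balaban1989LargeFieldI, (0.2)–(0.6) p.176, p.177, Prop. 1 (1.78) p.194, (1.80) p.195, (1.89) p.198; Balaban1988Convergent, p.244, Thm 2 p.263, (3.16)–(3.22) pp.268–269 (bookkeeping: the stub's body on a live re-pin)] -/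
theorem nodesAtSomeRecord₁₂_of_pointed_liveRepin_pinW_of_massSel_of_signs (hθ : Θ.Admissible F N) (hzt : Θ.ZtUnity F N) (hκ : 0 ≤ Θ.s2.lf.κ)
    (hE₀ : 0 ≤ Θ.s2.lf.E₀) (hB₀ : 0 ≤ Θ.s2.lf.B₀)
    (w : WorldP) (hC : w.C = (datumOfRecord₁₂ F N (Θ.liveRepin F N) hP).C) (hγ : 0 < w.γ ∧ w.γ ≤ Θ.γ) (hL : w.L = (Θ.L : ℝ))
    (hup : ∀ P, w.up P = upOfRecord₅C F N (((Θ.liveRepin F N).pinW F N (WOfRecord₁₂ F N (Θ.liveRepin F N)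
      ((lam.pinRPrime (Θ.liveRepin F N).toStage9Params).pinD189χ₀ (Θ.liveRepin F N).toStage9Params σ p₁))).toStage5₁₂ F N) P)
    (h05 : ∀ P : B12.RunParams,
      B8LeafR (Θ.res.X P).d8 (Θ.res.X P).L8 (Θ.res.X P).C₂ (Θ.res.X P).B₁' (Θ.res.X P).B₀' (Θ.res.X P).B₁ (Θ.res.X P).B₂ (Θ.res.X P).c₁
        (Θ.res.X P).inp8 (Θ.res.X P).B₀β (Θ.res.X P).loc8 (Θ.res.X P).fam8R (Θ.res.X P).lan8 (Θ.res.X P).cub8 (Θ.res.X P).toAxial8)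
    (h06 : ∀ P : B12.RunParams, B9LeafX (Θ.res.Y P))
    (h07 : ∀ P : B12.RunParams, B11Leaf (Θ.res.Z P))
    (h08 : ∀ P : B12.RunParams, ∃ (Xc : PrintedCarriersR) (I : Type) (C : B10Assembly.Consts) (T : I → B10.TowerRun),
      Nonempty (∀ i, B10Assembly.LeafSystem C (T i)) ∧ Θ.res.X P = Xc.withTowerRuns10 T)
    (h09 : ∀ P : B12.RunParams, B12Sec2to5.Lemma4Printed (Θ.res.X P).F12 (Θ.res.X P).c12)
    (h09T : ∀ P : B12.RunParams, (leavesP w P).smallCouplings → (leavesP w P).smallFieldInductive)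
    (h10 : ∀ P : B12.RunParams, B9LeafX (Θ.res.Y P) →
      (B10.Thm1PrintedCompact (Θ.res.X P).runs10 ∧ B10.Thm2Printed (Θ.res.X P).runs10) →
        B11Leaf (Θ.res.Z P) → B12Sec2to5.Lemma4Printed (Θ.res.X P).F12 (Θ.res.X P).c12 →
          B13.Lemma1Printed (Θ.res.X P).S13 (Θ.res.X P).c13 ∧ B13.Lemma2Printed (Θ.res.X P).S13 (Θ.res.X P).c13 ∧
            B13.Lemma3Printed (Θ.res.X P).S13 (Θ.res.X P).c13)
    (h11 : ∀ P : B12.RunParams, (leavesP w P).b7 → (leavesP w P).b8 → (leavesP w P).b9 → (leavesP w P).b10 → (leavesP w P).b11 →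
      (leavesP w P).smallCouplings → (leavesP w P).smallFieldInductive → (leavesP w P).flowControl →
        ∀ k, k < P.K → SLaw₁₂ F N (Θ.liveRepin F N) P k → TLaw₁₂ F N (Θ.liveRepin F N) P k)
    (hN12 : ∀ P : B12.RunParams,
      (P.K ≤ lam.kSel P →
        (repDataOfSel (repTOfRecord9 F N Θ.ν Θ.τ9 (EOfRecord₁₀ F N (Θ.liveRepin F N).toStage9Params) (wOfRecord₉ F N (Θ.liveRepin F N).toStage9Params)
            (Θ.liveRepin F N).ppSel P (gOfRecord₁₀ F N (Θ.liveRepin F N).toStage9Params P) (lam.kSel P))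
          ((Θ.liveRepin F N).ppSel P (gOfRecord₁₀ F N (Θ.liveRepin F N).toStage9Params P) (lam.kSel P + 1))
          (fibOfSeq F Θ.ν Θ.τ9 P (gOfRecord₁₀ F N (Θ.liveRepin F N).toStage9Params P) (lam.kSel P + 1))).ProvisosSupp) ∧
      (∀ s, 0 < ∫ V, rterm (repTOfRecord9 F N Θ.ν Θ.τ9 (EOfRecord₁₀ F N (Θ.liveRepin F N).toStage9Params) (wOfRecord₉ F N (Θ.liveRepin F N).toStage9Params)
        (Θ.liveRepin F N).ppSel P (gOfRecord₁₀ F N (Θ.liveRepin F N).toStage9Params P) (lam.kSel P))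
        ((Θ.liveRepin F N).ppSel P (gOfRecord₁₀ F N (Θ.liveRepin F N).toStage9Params P) (lam.kSel P + 1) s) V ∂(fieldMeasure (F.P P.K) (lam.kSel P + 1) (SU N))) ∧
      Prop1Printed (lam.LF P) ∧
      (∀ U, new189 (((lam.pinRPrime (Θ.liveRepin F N).toStage9Params).pinD189χ₀ (Θ.liveRepin F N).toStage9Params σ p₁).D189 P) U →
        ∀ i, (((lam.pinRPrime (Θ.liveRepin F N).toStage9Params).pinD189χ₀ (Θ.liveRepin F N).toStage9Params σ p₁).D189 P).h ≤ i →
          i ≤ (((lam.pinRPrime (Θ.liveRepin F N).toStage9Params).pinD189χ₀ (Θ.liveRepin F N).toStage9Params σ p₁).D189 P).k →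
            ∀ q ∈ plaqsOf (dom (((lam.pinRPrime (Θ.liveRepin F N).toStage9Params).pinD189χ₀ (Θ.liveRepin F N).toStage9Params σ p₁).D189 P) i),
              Ineq180 ((((lam.pinRPrime (Θ.liveRepin F N).toStage9Params).pinD189χ₀ (Θ.liveRepin F N).toStage9Params σ p₁).D189 P).dev0 U q)
                ((((lam.pinRPrime (Θ.liveRepin F N).toStage9Params).pinD189χ₀ (Θ.liveRepin F N).toStage9Params σ p₁).D189 P).ε
                  (((lam.pinRPrime (Θ.liveRepin F N).toStage9Params).pinD189χ₀ (Θ.liveRepin F N).toStage9Params σ p₁).D189 P).k)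
                (((lam.pinRPrime (Θ.liveRepin F N).toStage9Params).pinD189χ₀ (Θ.liveRepin F N).toStage9Params σ p₁).D189 P).η
                (σ P).B₃ (σ P).B₅ (σ P).M (σ P).δ ((σ P).dist q) (σ P).O1) ∧
      Claim189 (new189 (((lam.pinRPrime (Θ.liveRepin F N).toStage9Params).pinD189χ₀ (Θ.liveRepin F N).toStage9Params σ p₁).D189 P))
        (chiPP (((lam.pinRPrime (Θ.liveRepin F N).toStage9Params).pinD189χ₀ (Θ.liveRepin F N).toStage9Params σ p₁).D189 P)))
    (hcor3 : ∃ R : B14Cor3.ReprFamily (datumOfRecord₁₂ F N (Θ.liveRepin F N) hP).C,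
      B14Cor3.LeafH (datumOfRecord₁₂ F N (Θ.liveRepin F N) hP).C R w.γ ∧ B14Cor3.LeafU1 (datumOfRecord₁₂ F N (Θ.liveRepin F N) hP).C R w.γ ∧
        B14Cor3.LeafU2 (datumOfRecord₁₂ F N (Θ.liveRepin F N) hP).C R w.γ w.ep ∧ B14Cor3.LeafL1 (datumOfRecord₁₂ F N (Θ.liveRepin F N) hP).C R w.γ ∧
          B14Cor3.LeafL2 (datumOfRecord₁₂ F N (Θ.liveRepin F N) hP).C R w.γ w.em) :
    ∃ (θ' : Stage12Params F N) (h' : θ'.Provisos₁₂ F N) (w' : WorldP), (θ'.ZtUnity F N ∧ θ'.SlotsNondegenerate) ∧ θ'.Admissible F N ∧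
      IsRecordOfRecord₁₂C F N (datumOfRecord₁₂ F N θ' h') w' ∧ ∀ P : B12.RunParams, Nodes (leavesP w' P) :=
  nodesAtSomeRecord₁₂_of_pointed_liveRepin_pinW_of_massSel Θ hP lam σ p₁ hθ hzt (Stage12Params.slotsNondegenerate_liveRepin F N Θ hP.base)
    w hC hγ hL hup h05 h06 h07 h08 h09 h09T h10 h11 hN12 (rRow_liveRepin Θ hP hθ hκ hE₀ hB₀) hcor3

end Body

/-! ## §3 At `θ₀ˡⁱᵛᵉ = theta12LiveOfRecord F N ζ Rz Zt` for ANY residual objects: signs, admissibility, guard conjunct and 𝐑-row are theorems -/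

section Theta
variable (ζ : ZetaOfRecord F N numerics7OfRecord₁₂ 1) (Rz : (K : ℕ) → Sect2.Residual (F.P K) (MatA N)) (Zt : (K : ℕ) → TkResidualW F N (FluctV N) K)

/-- **N13's POINTED 𝐑-ROW AT `θ₀ˡⁱᵛᵉ` FROM THE PROVISOS THERE ALONE** (admissibility `admissible_theta12OfRecord`, signs `κ = E₀ = B₀ = 1` of the numerics of record — K0a ∕ n11-e
theorems; `0 ≤ g_{k+1}` by §0). [cite: Balaban1988Convergent, p.244, Thm 2 p.263; Balaban1989LargeFieldI, (0.3) p.176, p.177 (i)–(ii); Balaban1989LargeFieldII, Thm 1 p.355 (not exercised)] -/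
theorem rRow_theta12Live (hP : (theta12LiveOfRecord F N ζ Rz Zt).Provisos₁₂ F N) :
    ∀ (P : B12.RunParams) (k : ℕ), k < P.K →
      TLaw₁₂ F N (theta12LiveOfRecord F N ζ Rz Zt) P k → SLaw₁₂ F N (theta12LiveOfRecord F N ζ Rz Zt) P (k + 1) :=
  rRow_liveRepin (theta12OfRecord F N ζ Rz Zt) hP (admissible_theta12OfRecord F N ζ Rz Zt) (kappa_nonneg_theta12OfRecord F N ζ Rz Zt)
    (E0_nonneg_theta12OfRecord F N ζ Rz Zt) (B0_nonneg_theta12OfRecord F N ζ Rz Zt)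

variable (lam : ResidW F N) (σ : ∀ P : B12.RunParams, Sit189 F N P.K) (p₁ : ℕ)

/-- **★ THE BODY OF `NodesAtSomeRecord12` AT `θ₀ˡⁱᵛᵉ` FOR ANY RESIDUAL OBJECTS `(ζ, Rz, Zt)`, N12 READ AT ITS BUNDLE OF RECORD** (§2 at `Θ := theta12OfRecord F N ζ Rz Zt`):
K0′ side = `Provisos₁₂ θ₀ˡⁱᵛᵉ` + print's partition of unity `ZtUnity` (K0b proves it at `Zt := ZtOfRecord`; displayed here so the K1′ witness-to-be may choose its own
residual objects); admissibility, the signs, the guard conjunct `SlotsNondegenerate` and N13's 𝐑-row are THEOREMS.  Rows N05–N10 at `θ₀`'s residual carriers, N11's (S1ᵀ) and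
the Cor.-3 leaves as module 27; N12 = `hdeg ∧ hmassSel ∧ Prop 1 ∧ (1.80) ∧ (1.89)` at `λ⁴`.  COMPOSITE; NOT a discharge; count-neutral.
[cite: Balaban1989LargeFieldII, Thm 1 p.355 + p.391; Balaban1989LargeFieldI, (0.2)–(0.6) p.176, p.177, Prop. 1 (1.78) p.194, (1.80) p.195, (1.89) p.198; Balaban1988Convergent, p.244, Thm 2 p.263, (3.16)–(3.22) pp.268–269 (bookkeeping: the stub's body on the witness line)] -/
theorem nodesAtSomeRecord₁₂_of_pointed_theta12Live_pinW_of_massSel (hP : (theta12LiveOfRecord F N ζ Rz Zt).Provisos₁₂ F N)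
    (hzt : (theta12LiveOfRecord F N ζ Rz Zt).ZtUnity F N)
    (w : WorldP) (hC : w.C = (datumOfRecord₁₂ F N (theta12LiveOfRecord F N ζ Rz Zt) hP).C) (hγ : 0 < w.γ ∧ w.γ ≤ 1 / 2) (hL : w.L = 3)
    (hup : ∀ P, w.up P = upOfRecord₅C F N (((theta12LiveOfRecord F N ζ Rz Zt).pinW F N (WOfRecord₁₂ F N (theta12LiveOfRecord F N ζ Rz Zt)
      ((lam.pinRPrime (theta12LiveOfRecord F N ζ Rz Zt).toStage9Params).pinD189χ₀ (theta12LiveOfRecord F N ζ Rz Zt).toStage9Params σ p₁))).toStage5₁₂ F N) P)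
    (h05 : ∀ P : B12.RunParams,
      B8LeafR ((theta12OfRecord F N ζ Rz Zt).res.X P).d8 ((theta12OfRecord F N ζ Rz Zt).res.X P).L8 ((theta12OfRecord F N ζ Rz Zt).res.X P).C₂
        ((theta12OfRecord F N ζ Rz Zt).res.X P).B₁' ((theta12OfRecord F N ζ Rz Zt).res.X P).B₀' ((theta12OfRecord F N ζ Rz Zt).res.X P).B₁
        ((theta12OfRecord F N ζ Rz Zt).res.X P).B₂ ((theta12OfRecord F N ζ Rz Zt).res.X P).c₁ ((theta12OfRecord F N ζ Rz Zt).res.X P).inp8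
        ((theta12OfRecord F N ζ Rz Zt).res.X P).B₀β ((theta12OfRecord F N ζ Rz Zt).res.X P).loc8 ((theta12OfRecord F N ζ Rz Zt).res.X P).fam8R
        ((theta12OfRecord F N ζ Rz Zt).res.X P).lan8 ((theta12OfRecord F N ζ Rz Zt).res.X P).cub8 ((theta12OfRecord F N ζ Rz Zt).res.X P).toAxial8)
    (h06 : ∀ P : B12.RunParams, B9LeafX ((theta12OfRecord F N ζ Rz Zt).res.Y P))
    (h07 : ∀ P : B12.RunParams, B11Leaf ((theta12OfRecord F N ζ Rz Zt).res.Z P))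
    (h08 : ∀ P : B12.RunParams, ∃ (Xc : PrintedCarriersR) (I : Type) (C : B10Assembly.Consts) (T : I → B10.TowerRun),
      Nonempty (∀ i, B10Assembly.LeafSystem C (T i)) ∧ (theta12OfRecord F N ζ Rz Zt).res.X P = Xc.withTowerRuns10 T)
    (h09 : ∀ P : B12.RunParams, B12Sec2to5.Lemma4Printed ((theta12OfRecord F N ζ Rz Zt).res.X P).F12 ((theta12OfRecord F N ζ Rz Zt).res.X P).c12)
    (h09T : ∀ P : B12.RunParams, (leavesP w P).smallCouplings → (leavesP w P).smallFieldInductive)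
    (h10 : ∀ P : B12.RunParams, B9LeafX ((theta12OfRecord F N ζ Rz Zt).res.Y P) →
      (B10.Thm1PrintedCompact ((theta12OfRecord F N ζ Rz Zt).res.X P).runs10 ∧ B10.Thm2Printed ((theta12OfRecord F N ζ Rz Zt).res.X P).runs10) →
        B11Leaf ((theta12OfRecord F N ζ Rz Zt).res.Z P) →
          B12Sec2to5.Lemma4Printed ((theta12OfRecord F N ζ Rz Zt).res.X P).F12 ((theta12OfRecord F N ζ Rz Zt).res.X P).c12 →
            B13.Lemma1Printed ((theta12OfRecord F N ζ Rz Zt).res.X P).S13 ((theta12OfRecord F N ζ Rz Zt).res.X P).c13 ∧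
              B13.Lemma2Printed ((theta12OfRecord F N ζ Rz Zt).res.X P).S13 ((theta12OfRecord F N ζ Rz Zt).res.X P).c13 ∧
                B13.Lemma3Printed ((theta12OfRecord F N ζ Rz Zt).res.X P).S13 ((theta12OfRecord F N ζ Rz Zt).res.X P).c13)
    (h11 : ∀ P : B12.RunParams, (leavesP w P).b7 → (leavesP w P).b8 → (leavesP w P).b9 → (leavesP w P).b10 → (leavesP w P).b11 →
      (leavesP w P).smallCouplings → (leavesP w P).smallFieldInductive → (leavesP w P).flowControl →
        ∀ k, k < P.K → SLaw₁₂ F N (theta12LiveOfRecord F N ζ Rz Zt) P k → TLaw₁₂ F N (theta12LiveOfRecord F N ζ Rz Zt) P k)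
    (hN12 : ∀ P : B12.RunParams,
      (P.K ≤ lam.kSel P →
        (repDataOfSel (repTOfRecord9 F N numerics7OfRecord₁₂ towerNumericsOfRecord₁₂ (EOfRecord₁₀ F N (theta12LiveOfRecord F N ζ Rz Zt).toStage9Params)
            (wOfRecord₉ F N (theta12LiveOfRecord F N ζ Rz Zt).toStage9Params) (theta12LiveOfRecord F N ζ Rz Zt).ppSel P
            (gOfRecord₁₀ F N (theta12LiveOfRecord F N ζ Rz Zt).toStage9Params P) (lam.kSel P))
          ((theta12LiveOfRecord F N ζ Rz Zt).ppSel P (gOfRecord₁₀ F N (theta12LiveOfRecord F N ζ Rz Zt).toStage9Params P) (lam.kSel P + 1))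
          (fibOfSeq F numerics7OfRecord₁₂ towerNumericsOfRecord₁₂ P (gOfRecord₁₀ F N (theta12LiveOfRecord F N ζ Rz Zt).toStage9Params P) (lam.kSel P + 1))).ProvisosSupp) ∧
      (∀ s, 0 < ∫ V, rterm (repTOfRecord9 F N numerics7OfRecord₁₂ towerNumericsOfRecord₁₂ (EOfRecord₁₀ F N (theta12LiveOfRecord F N ζ Rz Zt).toStage9Params)
        (wOfRecord₉ F N (theta12LiveOfRecord F N ζ Rz Zt).toStage9Params) (theta12LiveOfRecord F N ζ Rz Zt).ppSel P
        (gOfRecord₁₀ F N (theta12LiveOfRecord F N ζ Rz Zt).toStage9Params P) (lam.kSel P))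
        ((theta12LiveOfRecord F N ζ Rz Zt).ppSel P (gOfRecord₁₀ F N (theta12LiveOfRecord F N ζ Rz Zt).toStage9Params P) (lam.kSel P + 1) s) V
          ∂(fieldMeasure (F.P P.K) (lam.kSel P + 1) (SU N))) ∧
      Prop1Printed (lam.LF P) ∧
      (∀ U, new189 (((lam.pinRPrime (theta12LiveOfRecord F N ζ Rz Zt).toStage9Params).pinD189χ₀ (theta12LiveOfRecord F N ζ Rz Zt).toStage9Params σ p₁).D189 P) U →
        ∀ i, (((lam.pinRPrime (theta12LiveOfRecord F N ζ Rz Zt).toStage9Params).pinD189χ₀ (theta12LiveOfRecord F N ζ Rz Zt).toStage9Params σ p₁).D189 P).h ≤ i →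
          i ≤ (((lam.pinRPrime (theta12LiveOfRecord F N ζ Rz Zt).toStage9Params).pinD189χ₀ (theta12LiveOfRecord F N ζ Rz Zt).toStage9Params σ p₁).D189 P).k →
            ∀ q ∈ plaqsOf (dom (((lam.pinRPrime (theta12LiveOfRecord F N ζ Rz Zt).toStage9Params).pinD189χ₀
                (theta12LiveOfRecord F N ζ Rz Zt).toStage9Params σ p₁).D189 P) i),
              Ineq180 ((((lam.pinRPrime (theta12LiveOfRecord F N ζ Rz Zt).toStage9Params).pinD189χ₀ (theta12LiveOfRecord F N ζ Rz Zt).toStage9Params σ p₁).D189 P).dev0 U q)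
                ((((lam.pinRPrime (theta12LiveOfRecord F N ζ Rz Zt).toStage9Params).pinD189χ₀ (theta12LiveOfRecord F N ζ Rz Zt).toStage9Params σ p₁).D189 P).ε
                  (((lam.pinRPrime (theta12LiveOfRecord F N ζ Rz Zt).toStage9Params).pinD189χ₀ (theta12LiveOfRecord F N ζ Rz Zt).toStage9Params σ p₁).D189 P).k)
                (((lam.pinRPrime (theta12LiveOfRecord F N ζ Rz Zt).toStage9Params).pinD189χ₀ (theta12LiveOfRecord F N ζ Rz Zt).toStage9Params σ p₁).D189 P).η
                (σ P).B₃ (σ P).B₅ (σ P).M (σ P).δ ((σ P).dist q) (σ P).O1) ∧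
      Claim189 (new189 (((lam.pinRPrime (theta12LiveOfRecord F N ζ Rz Zt).toStage9Params).pinD189χ₀ (theta12LiveOfRecord F N ζ Rz Zt).toStage9Params σ p₁).D189 P))
        (chiPP (((lam.pinRPrime (theta12LiveOfRecord F N ζ Rz Zt).toStage9Params).pinD189χ₀ (theta12LiveOfRecord F N ζ Rz Zt).toStage9Params σ p₁).D189 P)))
    (hcor3 : ∃ R : B14Cor3.ReprFamily (datumOfRecord₁₂ F N (theta12LiveOfRecord F N ζ Rz Zt) hP).C,
      B14Cor3.LeafH (datumOfRecord₁₂ F N (theta12LiveOfRecord F N ζ Rz Zt) hP).C R w.γ ∧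
        B14Cor3.LeafU1 (datumOfRecord₁₂ F N (theta12LiveOfRecord F N ζ Rz Zt) hP).C R w.γ ∧
          B14Cor3.LeafU2 (datumOfRecord₁₂ F N (theta12LiveOfRecord F N ζ Rz Zt) hP).C R w.γ w.ep ∧
            B14Cor3.LeafL1 (datumOfRecord₁₂ F N (theta12LiveOfRecord F N ζ Rz Zt) hP).C R w.γ ∧
              B14Cor3.LeafL2 (datumOfRecord₁₂ F N (theta12LiveOfRecord F N ζ Rz Zt) hP).C R w.γ w.em) :
    ∃ (θ' : Stage12Params F N) (h' : θ'.Provisos₁₂ F N) (w' : WorldP), (θ'.ZtUnity F N ∧ θ'.SlotsNondegenerate) ∧ θ'.Admissible F N ∧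
      IsRecordOfRecord₁₂C F N (datumOfRecord₁₂ F N θ' h') w' ∧ ∀ P : B12.RunParams, Nodes (leavesP w' P) :=
  nodesAtSomeRecord₁₂_of_pointed_liveRepin_pinW_of_massSel_of_signs (theta12OfRecord F N ζ Rz Zt) hP lam σ p₁ (admissible_theta12OfRecord F N ζ Rz Zt) hzt
    (kappa_nonneg_theta12OfRecord F N ζ Rz Zt) (E0_nonneg_theta12OfRecord F N ζ Rz Zt) (B0_nonneg_theta12OfRecord F N ζ Rz Zt)
    w hC hγ hL hup h05 h06 h07 h08 h09 h09T h10 h11 hN12 hcor3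

end Theta

/-! ## §4 At plan g65's K0′ witness of record `thetaLive` (K0b's residuals `zeta316OfRecord … 1 1`, `RzOfRecord`, `ZtOfRecord`): K0′ side = `Provisos₁₂` alone -/

section Record
variable (F N)

/-- **★ AT THE K0′ WITNESS OF RECORD EVERY K0′-SIDE INPUT OF THE `stub_nodes12` BODY BUT `Provisos₁₂` IS A THEOREM — AND SO IS N13's 𝐑-ROW**: from `hP` alone, the rev-15 guard
pair (K0a `ztUnity_theta12LiveOfRecord` at K0b's residuals of record + `slotsNondegenerate_theta12LiveOfRecord hP.base`), admissibility (`admissible_theta12LiveOfRecord`) and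
`∀ P k < K, TLaw₁₂ θ₀ˡⁱᵛᵉ P k → SLaw₁₂ θ₀ˡⁱᵛᵉ P (k+1)` (§3).  Feed `hzt := ztUnity_theta12LiveOfRecord F N` to §3's `nodesAtSomeRecord₁₂_of_pointed_theta12Live_pinW_of_massSel` for the
body at the witness of record (generic `N`).  LOCATED (not a second gap): dag-n11-d reads N11's (S1ᵀ) at level 0 as expected to FAIL at K0b's uniform `ζ0` (pub-ymgap INBOX
l.14524) — then §3's `h11` is unsatisfiable at THESE residual objects and a K1′ witness uses §3 with its own `(ζ, Rz, Zt)`.  NOT a discharge; count-neutral.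
[cite: Balaban1988Convergent, p.244, Thm 2 p.263, (3.16)–(3.22) pp.268–269, (3.24) p.270; Balaban1989LargeFieldI, (0.3)–(0.4) p.176, p.177 (i)–(ii); Balaban1989LargeFieldII, Thm 1 + (0.1) pp.355–356 (bookkeeping)] -/
theorem k0primeSide_and_rRow_at_thetaLiveOfRecord
    (hP : (theta12LiveOfRecord F N (zeta316OfRecord F N numerics7OfRecord₁₂ 1 1) (RzOfRecord F N) (ZtOfRecord F N)).Provisos₁₂ F N) :
    ((theta12LiveOfRecord F N (zeta316OfRecord F N numerics7OfRecord₁₂ 1 1) (RzOfRecord F N) (ZtOfRecord F N)).ZtUnity F N ∧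
        (theta12LiveOfRecord F N (zeta316OfRecord F N numerics7OfRecord₁₂ 1 1) (RzOfRecord F N) (ZtOfRecord F N)).SlotsNondegenerate) ∧
      (theta12LiveOfRecord F N (zeta316OfRecord F N numerics7OfRecord₁₂ 1 1) (RzOfRecord F N) (ZtOfRecord F N)).Admissible F N ∧
      ∀ (P : B12.RunParams) (k : ℕ), k < P.K →
        TLaw₁₂ F N (theta12LiveOfRecord F N (zeta316OfRecord F N numerics7OfRecord₁₂ 1 1) (RzOfRecord F N) (ZtOfRecord F N)) P k →
          SLaw₁₂ F N (theta12LiveOfRecord F N (zeta316OfRecord F N numerics7OfRecord₁₂ 1 1) (RzOfRecord F N) (ZtOfRecord F N)) P (k + 1) :=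
  ⟨⟨ztUnity_theta12LiveOfRecord F N, slotsNondegenerate_theta12LiveOfRecord F N _ _ _ hP.base⟩, admissible_theta12LiveOfRecord F N _ _ _,
    rRow_theta12Live _ _ _ hP⟩

/-- **`N = 2` (the route's group of record): FROM ONE HYPOTHESIS `hP` — K0′'s BODY FOR `F` (K0a's `exists_k0prime_of_theta12Live_of_provisos₁₂`, verbatim) AND N13's POINTED
𝐑-ROW AT THE SAME WITNESS.**  The K0′ ∕ K1′ pairing on plan g65's `thetaLive F` (SKELETON v4-LIVE): what `stub_nodes12` then still asks at this witness is the children's rows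
(N05–N11, Cor.-3, N12's displays) — §3.  NOT a stub close; NOT a discharge; count-neutral. [cite: Balaban1988Convergent, p.244, Thm 1 p.262, Thm 2 p.263, (3.16)–(3.22) pp.268–269; Balaban1989LargeFieldI, (0.3)–(0.4) p.176; Balaban1989LargeFieldII, Thm 1 + (0.1) pp.355–356 (bookkeeping)] -/
theorem k0prime_and_rRow_of_thetaLive_provisos_two (F : T4Family)
    (hP : (theta12LiveOfRecord F 2 (zeta316OfRecord F 2 numerics7OfRecord₁₂ 1 1) (RzOfRecord F 2) (ZtOfRecord F 2)).Provisos₁₂ F 2) :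
    (∃ θ : Stage12Params F 2, θ.Provisos₁₂ F 2 ∧ (θ.ZtUnity F 2 ∧ θ.SlotsNondegenerate) ∧ θ.Admissible F 2) ∧
      ∀ (P : B12.RunParams) (k : ℕ), k < P.K →
        TLaw₁₂ F 2 (theta12LiveOfRecord F 2 (zeta316OfRecord F 2 numerics7OfRecord₁₂ 1 1) (RzOfRecord F 2) (ZtOfRecord F 2)) P k →
          SLaw₁₂ F 2 (theta12LiveOfRecord F 2 (zeta316OfRecord F 2 numerics7OfRecord₁₂ 1 1) (RzOfRecord F 2) (ZtOfRecord F 2)) P (k + 1) :=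
  ⟨exists_k0prime_of_theta12Live_of_provisos₁₂ F hP, rRow_theta12Live _ _ _ hP⟩

end Record

end Summit.QuantumFields.YangMills.BalabanUVNodes.N12AtRecord12WitnessLine

end
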